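import Mathlib
import Literature.AlgebraicGeometry.Resolution.FormalCoordinateChange
import Literature.AlgebraicGeometry.Resolution.FormalInverseFunction
import Literature.AlgebraicGeometry.Resolution.CobordantArcLemma
import Literature.AlgebraicGeometry.Resolution.FormalShear

/-!
# `(1, N)`-weighted initial forms of plane germs under weighted-homogeneous reparametrisations

Folklore infrastructure about `MvPowerSeries (Fin 2) k` (`x = X 0`, `y = X 1`, `k` a field),
written for the plane case of the local weighted resolution game (crux `LocalWeightedDrop`,
stmt-ResolutionOfSingularities-8899: the step "prepared maximal-contact coordinates", file
`Summits/…/Theorems/WeightedInvariantLocalWeightedDropPrepareContact.lean`), in the vocabulary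
of `Mathlib.RingTheory.MvPowerSeries.Substitution` and `MvPowerSeries.weightedOrder`.

Weights `![1, N]`: the monomial `xⁱ yʲ` has weight `i + N j` (`weight_fin_two`).  A germ `g` has
"contact `≥ N`" (with respect to a prospective order `d`) when its `(1, N)`-weighted order is
`≥ N d`; its `(1, N)`-INITIAL PART is then the finite sum
`∑_{j ≤ d} a_j x^{N (d - j)} y^j`, `a_j = coeff (N (d - j), j) g` (these are exactly the
exponents of weight `N d` when `N ≥ 1`, `eq_of_weight_eq`), and `g` minus its initial part has
weighted order `≥ N d + 1` (`weightedOrder_sub_initial`).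

* MONOTONICITY (`weightedOrder_le_weightedOrder_subst`): a substitution `τ` with
  `wt-ord (τ 0) ≥ 1`, `wt-ord (τ 1) ≥ N` does not lower the `(1, N)`-weighted order
  (`MvPowerSeries.le_weightedOrder_subst`); hence the coefficients of weight `≤ N d` of
  `g ∘ τ` only see the initial part of `g` (`coeff_subst_of_weight_le`).
* THE SHIFTS `σ_a = (x, y + a xᴺ)`: legal coordinate changes of the above kind
  (`constantCoeff_shift`, `det_linMat_shift`, `le_weightedOrder_shift`); if the initial part of
  `g` is the pure power `β (y - a xᴺ)^d`, i.e. `a_j = β · C(d, j) · (-a)^{d - j}`, then the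
  initial part of `g ∘ σ_a` is `β y^d` (`sum_smul_shift_pow`, the binomial theorem, and
  `coeff_subst_shift_of_pure_power`).
* THE LINEAR MAPS `τ_c = (x + c y, y)` (`N = 1`): the `y^d`-coefficient of `g ∘ τ_c` is
  `∑_j a_j c^{d - j}` (`coeff_single_linear_pow`, `coeff_subst_linear`), a non-zero polynomial
  in `c` as soon as some `a_j ≠ 0`, so over an infinite field some `c` makes it non-zero
  (`exists_sum_mul_pow_ne_zero`).
* LEGAL COORDINATE CHANGES (zero constant terms, invertible linear part) preserve the order
  (`order_subst_of_isUnit_det`, via `FormalCoordChange.exists_comp_inverse`) and compose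
  with the above `τ` keeping contact `≥ N` (`comp_step`).

No definitions.  Deliberately NOT here: more than two variables, general weights.
-/

open MvPowerSeries

namespace Literature.AlgebraicGeometry.Resolution.WeightedShear

variable {k : Type*} [Field k]

/-! ### 1. `(1, N)`-weights and the initial part -/

/-- The `(M, N)`-weight of an exponent `(i, j)` is `M i + N j`. [folklore] -/
theorem weight_fin_two (M N : ℕ) (e : Fin 2 →₀ ℕ) : Finsupp.weight ![M, N] e = M * e 0 + N * e 1 := by
  rw [Finsupp.weight_apply, Finsupp.sum_fintype _ _ (fun i => by simp)]
  simp [Fin.sum_univ_two, mul_comm]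

/-- For `N ≥ 1`, an exponent of `(1, N)`-weight `N d` is `(N (d - j), j)` with `j ≤ d`.
[folklore] -/
theorem eq_of_weight_eq {N d : ℕ} (hN : 1 ≤ N) {e : Fin 2 →₀ ℕ} (he : e 0 + N * e 1 = N * d) :
    e 1 ≤ d ∧ e = Finsupp.single 0 (N * (d - e 1)) + Finsupp.single 1 (e 1) := by
  have h1 : e 1 ≤ d := by
    by_contra h
    have h2 : N * d < N * e 1 := Nat.mul_lt_mul_of_pos_left (by omega) (by omega)
    omega
  refine ⟨h1, Finsupp.ext fun i => ?_⟩
  have h3 : N * (d - e 1) = N * d - N * e 1 := Nat.mul_sub N d (e 1)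
  fin_cases i
  · simp only [Fin.zero_eta, Fin.isValue, Finsupp.coe_add, Pi.add_apply, Finsupp.single_eq_same,
      ne_eq, zero_ne_one, not_false_eq_true, Finsupp.single_eq_of_ne, add_zero]
    omega
  · simp

/-- Coefficients of a finite sum of monomials of `(1, N)`-weight `N d` (`N ≥ 1`). [folklore] -/
theorem coeff_sum_monomial {N : ℕ} (hN : 1 ≤ N) (d : ℕ) (c : ℕ → k) (e : Fin 2 →₀ ℕ) :
    coeff e (∑ j ∈ Finset.range (d + 1),
      monomial (Finsupp.single 0 (N * (d - j)) + Finsupp.single 1 j) (c j)) =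
      if e 0 + N * e 1 = N * d then c (e 1) else 0 := by
  classical
  simp only [map_sum, coeff_monomial]
  split_ifs with h
  · obtain ⟨hle, heq⟩ := eq_of_weight_eq hN h
    rw [Finset.sum_eq_single (e 1), if_pos heq]
    · intro j _ hj
      rw [if_neg]
      intro h'
      exact hj (by simpa using congrArg (fun f : Fin 2 →₀ ℕ => f 1) h' : e 1 = j).symm
    · intro h'
      exact absurd (Finset.mem_range.mpr (Nat.lt_succ_of_le hle)) h'
  · refine Finset.sum_eq_zero fun j hj => ?_
    rw [if_neg]
    rintro rfl
    have hj' : j ≤ d := Nat.lt_succ_iff.mp (Finset.mem_range.mp hj)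
    have h2 : N * (d - j) + N * j = N * d := by rw [← Nat.mul_add, Nat.sub_add_cancel hj']
    exact h (by simpa using h2)

/-- THE INITIAL PART: if `wt-ord g ≥ N d` (`N ≥ 1`) then `g - ∑_{j ≤ d} a_j x^{N(d-j)} y^j`,
`a_j = coeff (N (d - j), j) g`, has weighted order `≥ N d + 1`. [folklore] -/
theorem weightedOrder_sub_initial {N d : ℕ} (hN : 1 ≤ N) {g : MvPowerSeries (Fin 2) k}
    (hg : ((N * d : ℕ) : ℕ∞) ≤ weightedOrder ![1, N] g) :
    ((N * d + 1 : ℕ) : ℕ∞) ≤ weightedOrder ![1, N]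
      (g - ∑ j ∈ Finset.range (d + 1),
        monomial (Finsupp.single 0 (N * (d - j)) + Finsupp.single 1 j)
          (coeff (Finsupp.single 0 (N * (d - j)) + Finsupp.single 1 j) g)) := by
  apply nat_le_weightedOrder
  intro e he
  rw [weight_fin_two] at he
  rw [map_sub, coeff_sum_monomial hN, sub_eq_zero]
  split_ifs with h
  · obtain ⟨-, heq⟩ := eq_of_weight_eq hN h
    conv_lhs => rw [heq]
  · refine coeff_eq_zero_of_lt_weightedOrder _ (lt_of_lt_of_le ?_ hg)
    rw [weight_fin_two]
    exact_mod_cast (by omega : 1 * e 0 + N * e 1 < N * d)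

/-! ### 2. Substitutions that do not lower the `(1, N)`-weighted order -/

/-- MONOTONICITY: if `wt-ord (τ 0) ≥ 1` and `wt-ord (τ 1) ≥ N` then `g ↦ g ∘ τ` does not lower
the `(1, N)`-weighted order. [folklore] -/
theorem weightedOrder_le_weightedOrder_subst {N : ℕ} {τ : Fin 2 → MvPowerSeries (Fin 2) k}
    (hτ : ∀ i, constantCoeff (τ i) = 0) (h0 : (1 : ℕ∞) ≤ weightedOrder ![1, N] (τ 0))
    (h1 : (N : ℕ∞) ≤ weightedOrder ![1, N] (τ 1)) (H : MvPowerSeries (Fin 2) k) :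
    weightedOrder ![1, N] H ≤ weightedOrder ![1, N] (subst τ H) := by
  refine le_trans ?_ (le_weightedOrder_subst _ (hasSubst_of_constantCoeff_zero hτ) H)
  refine le_iInf₂ fun e he => (weightedOrder_le _ he).trans ?_
  rw [weight_fin_two, one_mul, Finsupp.weight_apply, Finsupp.sum_fintype _ _ (fun i => by simp),
    Fin.sum_univ_two]
  simp only [Function.comp_apply, nsmul_eq_mul]
  push_cast
  calc ((e 0 : ℕ) : ℕ∞) + (N : ℕ∞) * ((e 1 : ℕ) : ℕ∞)
      = ((e 0 : ℕ) : ℕ∞) * 1 + ((e 1 : ℕ) : ℕ∞) * N := by ring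
    _ ≤ ((e 0 : ℕ) : ℕ∞) * weightedOrder ![1, N] (τ 0) +
          ((e 1 : ℕ) : ℕ∞) * weightedOrder ![1, N] (τ 1) := by gcongr

/-- Substituting into a finite sum of monomials `∑_{j ≤ d} c_j x^{N(d-j)} y^j`. [folklore] -/
theorem subst_sum_monomial {τ : Fin 2 → MvPowerSeries (Fin 2) k} (hτ : HasSubst τ) (N d : ℕ)
    (c : ℕ → k) :
    subst τ (∑ j ∈ Finset.range (d + 1),
      monomial (Finsupp.single 0 (N * (d - j)) + Finsupp.single 1 j) (c j)) =
      ∑ j ∈ Finset.range (d + 1), c j • (τ 0 ^ (N * (d - j)) * τ 1 ^ j) := by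
  rw [← coe_substAlgHom hτ, map_sum]
  refine Finset.sum_congr rfl fun j _ => ?_
  rw [coe_substAlgHom, subst_monomial hτ, Finsupp.prod_fintype _ _ (fun i => pow_zero _),
    Fin.prod_univ_two, Algebra.smul_def]
  simp

/-- INITIAL COEFFICIENTS AFTER A WEIGHTED REPARAMETRISATION: for `τ` as in
`weightedOrder_le_weightedOrder_subst` and `wt-ord g ≥ N d`, the coefficients of weight `≤ N d`
of `g ∘ τ` are those of `∑_{j ≤ d} a_j (τ 0)^{N(d-j)} (τ 1)^j`. [folklore] -/
theorem coeff_subst_of_weight_le {N d : ℕ} (hN : 1 ≤ N) {τ : Fin 2 → MvPowerSeries (Fin 2) k}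
    (hτ : ∀ i, constantCoeff (τ i) = 0) (h0 : (1 : ℕ∞) ≤ weightedOrder ![1, N] (τ 0))
    (h1 : (N : ℕ∞) ≤ weightedOrder ![1, N] (τ 1)) {g : MvPowerSeries (Fin 2) k}
    (hg : ((N * d : ℕ) : ℕ∞) ≤ weightedOrder ![1, N] g) {e : Fin 2 →₀ ℕ}
    (he : e 0 + N * e 1 ≤ N * d) :
    coeff e (subst τ g) = coeff e (∑ j ∈ Finset.range (d + 1),
      coeff (Finsupp.single 0 (N * (d - j)) + Finsupp.single 1 j) g •
        (τ 0 ^ (N * (d - j)) * τ 1 ^ j)) := by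
  have hτs : HasSubst τ := hasSubst_of_constantCoeff_zero hτ
  have hH := weightedOrder_sub_initial hN hg
  rw [← subst_sum_monomial hτs]
  set I : MvPowerSeries (Fin 2) k := ∑ j ∈ Finset.range (d + 1),
    monomial (Finsupp.single 0 (N * (d - j)) + Finsupp.single 1 j)
      (coeff (Finsupp.single 0 (N * (d - j)) + Finsupp.single 1 j) g)
  have hsplit : subst τ g = subst τ I + subst τ (g - I) := by
    rw [← subst_add hτs, add_sub_cancel]
  rw [hsplit, map_add, add_eq_left]
  refine coeff_eq_zero_of_lt_weightedOrder _ (lt_of_lt_of_le ?_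
    (hH.trans (weightedOrder_le_weightedOrder_subst hτ h0 h1 _)))
  rw [weight_fin_two]
  exact_mod_cast (by omega : 1 * e 0 + N * e 1 < N * d + 1)

/-! ### 3. The shifts `σ_a = (x, y + a xᴺ)` -/

/-- The components of `σ_a` have zero constant terms (`N ≥ 1`). [folklore] -/
theorem constantCoeff_shift {N : ℕ} (hN : 1 ≤ N) (a : k) :
    ∀ i, constantCoeff ((![X 0, X 1 + C a * X 0 ^ N] : Fin 2 → MvPowerSeries (Fin 2) k) i) = 0 := by
  intro i
  fin_cases i
  · exact constantCoeff_X 0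
  · show constantCoeff (X 1 + C a * X 0 ^ N) = 0
    rw [map_add, constantCoeff_X, map_mul, map_pow, constantCoeff_X, zero_pow (by omega), mul_zero,
      add_zero]

/-- The linear part of `σ_a` has determinant `1`. [folklore] -/
theorem det_linMat_shift (N : ℕ) (a : k) :
    (Matrix.of fun i j => coeff (Finsupp.single j 1)
      ((![X 0, X 1 + C a * X 0 ^ N] : Fin 2 → MvPowerSeries (Fin 2) k) i)).det = 1 := by
  classical
  simp [Matrix.det_fin_two, coeff_X_pow, coeff_X, Finsupp.single_eq_single_iff]

/-- `wt-ord x = 1 ≥ 1`. [folklore] -/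
theorem one_le_weightedOrder_X_zero (N : ℕ) :
    (1 : ℕ∞) ≤ weightedOrder ![1, N] (X 0 : MvPowerSeries (Fin 2) k) := by
  rw [X_def, weightedOrder_monomial_of_ne_zero _ one_ne_zero, weight_fin_two]
  simp

/-- `wt-ord y = N ≥ N`. [folklore] -/
theorem le_weightedOrder_X_one (N : ℕ) :
    (N : ℕ∞) ≤ weightedOrder ![1, N] (X 1 : MvPowerSeries (Fin 2) k) := by
  rw [X_def, weightedOrder_monomial_of_ne_zero _ one_ne_zero, weight_fin_two]
  simp

/-- `wt-ord (y + a xᴺ) ≥ N`. [folklore] -/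
theorem le_weightedOrder_shift (N : ℕ) (a : k) :
    (N : ℕ∞) ≤ weightedOrder ![1, N] (X 1 + C a * X 0 ^ N : MvPowerSeries (Fin 2) k) := by
  classical
  apply nat_le_weightedOrder
  intro e he
  rw [weight_fin_two] at he
  rw [map_add, coeff_X, coeff_C_mul, coeff_X_pow, if_neg, if_neg, mul_zero, add_zero]
  · rintro rfl
    simp at he
  · rintro rfl
    simp at he

/-- THE BINOMIAL IDENTITY behind the shift: `∑_j β C(d,j) (-a)^{d-j} x^{N(d-j)} (y + a xᴺ)^j
= β y^d`. [folklore] -/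
theorem sum_smul_shift_pow (β a : k) (N d : ℕ) :
    ∑ j ∈ Finset.range (d + 1), (β * (d.choose j : k) * (-a) ^ (d - j)) •
      ((X 0 : MvPowerSeries (Fin 2) k) ^ (N * (d - j)) * (X 1 + C a * X 0 ^ N) ^ j) =
      C β * X 1 ^ d := by
  have h := add_pow (X 1 + C a * X 0 ^ N : MvPowerSeries (Fin 2) k) (-(C a * X 0 ^ N)) d
  rw [add_neg_cancel_right] at h
  rw [h, Finset.mul_sum]
  refine Finset.sum_congr rfl fun j _ => ?_
  rw [smul_eq_C_mul]
  simp only [map_mul, map_pow, map_neg, map_natCast]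
  rw [neg_pow, neg_pow (C a * X 0 ^ N), mul_pow, ← pow_mul]
  ring

/-- PURE-POWER INITIAL FORMS BECOME `β y^d`: if `wt-ord g ≥ N d` (`N ≥ 1`) and
`a_j = β C(d,j) (-a)^{d-j}` for all `j ≤ d`, then the initial coefficients of `g ∘ σ_a` are
`a'_d = β` and `a'_j = 0` (`j < d`). [folklore] -/
theorem coeff_subst_shift_of_pure_power {N d : ℕ} (hN : 1 ≤ N) {g : MvPowerSeries (Fin 2) k}
    (hg : ((N * d : ℕ) : ℕ∞) ≤ weightedOrder ![1, N] g) {β a : k}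
    (hpure : ∀ j ∈ Finset.range (d + 1),
      coeff (Finsupp.single 0 (N * (d - j)) + Finsupp.single 1 j) g =
        β * (d.choose j : k) * (-a) ^ (d - j))
    {j : ℕ} (hj : j ≤ d) :
    coeff (Finsupp.single 0 (N * (d - j)) + Finsupp.single 1 j)
      (subst ![X 0, X 1 + C a * X 0 ^ N] g : MvPowerSeries (Fin 2) k) = if j = d then β else 0 := by
  classical
  rw [coeff_subst_of_weight_le hN (constantCoeff_shift hN a) (one_le_weightedOrder_X_zero N)
    (le_weightedOrder_shift N a) hg]
  · rw [Finset.sum_congr rfl fun i hi => by rw [hpure i hi]]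
    change coeff _ (∑ x ∈ Finset.range (d + 1), (β * (d.choose x : k) * (-a) ^ (d - x)) •
      ((X 0 : MvPowerSeries (Fin 2) k) ^ (N * (d - x)) * (X 1 + C a * X 0 ^ N) ^ x)) = _
    rw [sum_smul_shift_pow, coeff_C_mul, coeff_X_pow]
    by_cases hjd : j = d
    · subst hjd
      simp
    · rw [if_neg, if_neg hjd, mul_zero]
      exact fun h => hjd (by simpa using congrArg (fun f : Fin 2 →₀ ℕ => f 1) h)
  · have h2 : N * (d - j) + N * j = N * d := by rw [← Nat.mul_add, Nat.sub_add_cancel hj]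
    simpa using h2.le

/-! ### 4. The linear maps `τ_c = (x + c y, y)` (`N = 1`) -/

/-- The components of `τ_c` have zero constant terms. [folklore] -/
theorem constantCoeff_linear (c : k) :
    ∀ i, constantCoeff ((![X 0 + C c * X 1, X 1] : Fin 2 → MvPowerSeries (Fin 2) k) i) = 0 := by
  intro i
  fin_cases i
  · show constantCoeff (X 0 + C c * X 1) = 0
    rw [map_add, map_mul, constantCoeff_X, constantCoeff_X, mul_zero, add_zero]
  · exact constantCoeff_X 1

/-- The linear part of `τ_c` has determinant `1`. [folklore] -/
theorem det_linMat_linear (c : k) :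
    (Matrix.of fun i j => coeff (Finsupp.single j 1)
      ((![X 0 + C c * X 1, X 1] : Fin 2 → MvPowerSeries (Fin 2) k) i)).det = 1 := by
  classical
  simp [Matrix.det_fin_two, coeff_X, Finsupp.single_eq_single_iff]

/-- `wt-ord (x + c y) ≥ 1` for the weights `(1, 1)`. [folklore] -/
theorem one_le_weightedOrder_linear (c : k) :
    (1 : ℕ∞) ≤ weightedOrder ![1, 1] (X 0 + C c * X 1 : MvPowerSeries (Fin 2) k) := by
  apply nat_le_weightedOrder
  intro e he
  rw [weight_fin_two] at he
  have he0 : e = 0 := by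
    ext i
    fin_cases i <;> simp <;> omega
  rw [he0, coeff_zero_eq_constantCoeff_apply]
  exact constantCoeff_linear c 0

/-- The `y^d`-coefficient of `(x + c y)^m y^j`, `m + j = d`, is `c^m`. [folklore] -/
theorem coeff_single_linear_pow (c : k) {m j d : ℕ} (h : m + j = d) :
    coeff (Finsupp.single 1 d) (((X 0 : MvPowerSeries (Fin 2) k) + C c * X 1) ^ m * X 1 ^ j) =
      c ^ m := by
  classical
  rw [add_comm, add_pow, Finset.sum_mul, map_sum, Finset.sum_eq_single m]
  · rw [Nat.sub_self, pow_zero, mul_one, Nat.choose_self, Nat.cast_one, mul_one, mul_pow,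
      ← map_pow, mul_assoc, ← pow_add, coeff_C_mul, h, coeff_X_pow, if_pos rfl, mul_one]
  · intro i hi him
    have hlt : i < m := lt_of_le_of_ne (Nat.lt_succ_iff.mp (Finset.mem_range.mp hi)) him
    have hdvd : (X 0 : MvPowerSeries (Fin 2) k) ^ (m - i) ∣
        (C c * X 1) ^ i * X 0 ^ (m - i) * (m.choose i : MvPowerSeries (Fin 2) k) * X 1 ^ j :=
      dvd_mul_of_dvd_left (dvd_mul_of_dvd_left (dvd_mul_left _ _) _) _
    exact X_pow_dvd_iff.mp hdvd _ (by simpa using hlt)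
  · intro hm
    exact absurd (Finset.mem_range.mpr (Nat.lt_succ_self m)) hm

/-- THE `y^d`-COEFFICIENT AFTER `τ_c`: if `ord g ≥ d` (as `wt-ord` for the weights `(1, 1)`)
then `coeff y^d (g ∘ τ_c) = ∑_{j ≤ d} a_j c^{d-j}`, `a_j = coeff (d - j, j) g` (the factors
`1 * _` keep the shape `N * _` of the weighted statements, `N = 1`). [folklore] -/
theorem coeff_subst_linear {d : ℕ} {g : MvPowerSeries (Fin 2) k}
    (hg : ((1 * d : ℕ) : ℕ∞) ≤ weightedOrder ![1, 1] g) (c : k) :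
    coeff (Finsupp.single 1 d) (subst ![X 0 + C c * X 1, X 1] g : MvPowerSeries (Fin 2) k) =
      ∑ j ∈ Finset.range (d + 1),
        coeff (Finsupp.single 0 (1 * (d - j)) + Finsupp.single 1 j) g * c ^ (d - j) := by
  rw [coeff_subst_of_weight_le le_rfl (constantCoeff_linear c) (one_le_weightedOrder_linear c)
    (by exact_mod_cast le_weightedOrder_X_one (k := k) 1) hg (by simp), map_sum]
  refine Finset.sum_congr rfl fun j hj => ?_
  have hj' : j ≤ d := Nat.lt_succ_iff.mp (Finset.mem_range.mp hj)
  rw [map_smul, smul_eq_mul]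
  congr 1
  show coeff (Finsupp.single 1 d) ((X 0 + C c * X 1) ^ (1 * (d - j)) * X 1 ^ j) = c ^ (d - j)
  rw [one_mul]
  exact coeff_single_linear_pow c (Nat.sub_add_cancel hj')

/-- Over an infinite field a non-trivial combination `∑_{j ≤ d} c_j t^{d-j}` has a non-zero
value. [folklore] -/
theorem exists_sum_mul_pow_ne_zero [Infinite k] {d : ℕ} (c : ℕ → k)
    (hc : ∃ j ∈ Finset.range (d + 1), c j ≠ 0) :
    ∃ t : k, ∑ j ∈ Finset.range (d + 1), c j * t ^ (d - j) ≠ 0 := by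
  classical
  set Q : Polynomial k := ∑ j ∈ Finset.range (d + 1),
    Polynomial.C (c j) * Polynomial.X ^ (d - j) with hQ
  have hQne : Q ≠ 0 := by
    obtain ⟨j, hj, hcj⟩ := hc
    intro h0
    apply hcj
    have h1 := congrArg (fun P : Polynomial k => P.coeff (d - j)) h0
    simp only [hQ, Polynomial.finsetSum_coeff, Polynomial.coeff_C_mul_X_pow,
      Polynomial.coeff_zero] at h1
    rw [Finset.sum_eq_single j] at h1
    · simpa using h1
    · intro i hi hij
      rw [if_neg]
      have h2 := Finset.mem_range.mp hi
      have h3 := Finset.mem_range.mp hj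
      omega
    · intro h
      exact absurd hj h
  obtain ⟨t, ht⟩ := Infinite.exists_notMem_finset Q.roots.toFinset
  refine ⟨t, fun h => ht ?_⟩
  rw [Multiset.mem_toFinset, Polynomial.mem_roots hQne, Polynomial.IsRoot.def, hQ,
    Polynomial.eval_finsetSum]
  simpa [Polynomial.eval_mul, Polynomial.eval_pow, Polynomial.eval_C, Polynomial.eval_X] using h

/-! ### 5. Legal coordinate changes: order preservation and composition -/

/-- A legal formal coordinate change (zero constant terms, invertible linear part) preserves
the order. [folklore] -/
theorem order_subst_of_isUnit_det {Φ : Fin 2 → MvPowerSeries (Fin 2) k}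
    (hΦ0 : ∀ i, constantCoeff (Φ i) = 0) (hdet : IsUnit (FormalCoordChange.linMat Φ).det)
    (f : MvPowerSeries (Fin 2) k) : (subst Φ f).order = f.order := by
  refine le_antisymm ?_ (FormalShear.order_le_order_subst' Φ hΦ0 f)
  obtain ⟨ψ, hψ0, hψΦ, -⟩ := FormalCoordChange.exists_comp_inverse hΦ0 hdet
  calc (subst Φ f).order ≤ (subst ψ (subst Φ f)).order :=
        FormalShear.order_le_order_subst' ψ hψ0 _
    _ = f.order := by
      rw [subst_comp_subst_apply (hasSubst_of_constantCoeff_zero hΦ0)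
        (hasSubst_of_constantCoeff_zero hψ0), show (fun s => subst ψ (Φ s)) = X from funext hψΦ,
        subst_self]
      rfl

/-- ONE REPARAMETRISATION STEP: composing a legal coordinate change `Φ` (zero constant terms,
invertible linear part) with a legal `τ` as in `weightedOrder_le_weightedOrder_subst` gives a
legal `Φ ∘ τ := (τ^* Φ_i)_i` with `f ∘ (Φ ∘ τ) = (f ∘ Φ) ∘ τ`, and contact `≥ N` is kept.
[folklore] -/
theorem comp_step {N d : ℕ} {f : MvPowerSeries (Fin 2) k} {Φ τ : Fin 2 → MvPowerSeries (Fin 2) k}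
    (hΦ0 : ∀ i, constantCoeff (Φ i) = 0) (hΦdet : IsUnit (FormalCoordChange.linMat Φ).det)
    (hw : ((N * d : ℕ) : ℕ∞) ≤ weightedOrder ![1, N] (subst Φ f))
    (hτ0 : ∀ i, constantCoeff (τ i) = 0) (hτdet : IsUnit (FormalCoordChange.linMat τ).det)
    (h0 : (1 : ℕ∞) ≤ weightedOrder ![1, N] (τ 0)) (h1 : (N : ℕ∞) ≤ weightedOrder ![1, N] (τ 1)) :
    (∀ i, constantCoeff (subst τ (Φ i)) = 0) ∧
      IsUnit (FormalCoordChange.linMat (fun i => subst τ (Φ i))).det ∧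
      ((N * d : ℕ) : ℕ∞) ≤ weightedOrder ![1, N] (subst (fun i => subst τ (Φ i)) f) ∧
      subst (fun i => subst τ (Φ i)) f = subst τ (subst Φ f) := by
  have hτs : HasSubst τ := hasSubst_of_constantCoeff_zero hτ0
  have hcomp : subst (fun i => subst τ (Φ i)) f = subst τ (subst Φ f) :=
    (subst_comp_subst_apply (hasSubst_of_constantCoeff_zero hΦ0) hτs f).symm
  refine ⟨fun i => constantCoeff_subst_eq_zero hτs hτ0 (hΦ0 i), ?_,
    hcomp ▸ hw.trans (weightedOrder_le_weightedOrder_subst hτ0 h0 h1 _), hcomp⟩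
  have h : FormalCoordChange.linMat (fun i => subst τ (Φ i)) =
      FormalCoordChange.linMat Φ * FormalCoordChange.linMat τ := by
    ext i j
    simp only [FormalCoordChange.linMat, Matrix.of_apply, Matrix.mul_apply]
    exact CobordantArc.coeff_degree_one_subst τ hτ0 (Φ i) _ (Finsupp.degree_single _ _)
  rw [h, Matrix.det_mul]
  exact hΦdet.mul hτdet

end Literature.AlgebraicGeometry.Resolution.WeightedShear
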